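import Mathlib
import Summits.AtomisticToContinuum.HydrodynamicLimit.Theorems.InformationPercolationEngineKickFairRelEquilibriumMesoWindowCut
import Summits.AtomisticToContinuum.HydrodynamicLimit.Theorems.InformationPercolationEngineKickFairRelEquilibriumMesoLongWindowDefs
import HarnessLib

/-!
# `KickFairRelEquilibriumMeso`, line `kinetic-window-cut` rev 5 — the LONG-FLIGHT window cut: SWL ∧ CPL ⟹ TFL

Prover file (`--supports stmt-AtomisticToContinuum-15177`, wave 1, lead c8) for the registered sub-goal
`truncatedFluctuationLong_of_window : SameWindowPairCovLong rs → ClosePairCountLong rs → TruncatedFluctuationLong rs` of the line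
`kinetic-window-cut` (rev 5) of the crux `…Theses.InformationPercolationEngine.KickFairRelEquilibriumMeso`.
It is the landed window cut `truncatedFluctuation_of_window` (`…MesoWindowCut`, SW ∧ CP ⟹ TF) with the validity events cut to LONG
flights: the weights `h` of TFL vanish off `IsLong A (tN N)`, so `|w^v_k| ≤ 1_{v^v_k ∩ L_k}` (`abs_winWt_le_long`, `L_k = P_k⁻¹{IsLong}` the
`pastSA`-event "the flight of `k` is long"); the abstract pair expansion on the join (`stub_pairExpansion2`) is run window by window with
validity events `winEv ∩ L` and, as order events, the rev-5 FAR-pair events `{PairFarL (P_k) (P_l)}` (`joinSA`-measurable by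
`measurableSet_pairFarL`); in a common window "not far" is "close" (`winEvL_inter_subset_closeEvL`: `SameWindow ∧ ¬ PairFarL → PairCloseL`),
so, summed over the `⌊τ/t_N⌋₊ + 1 ≤ (τ+1)(N+1)^{1/3}` windows (`card_windows_le`, `windowPairSum_le`), the far piece is dominated a.e. by the
SWL integrand and the unordered piece by the CPL integrand, in the `lintegral` currency. The index-truncation level `A'` is arbitrary
(`truncSum_ae_eq` holds at every real level), which is why TFL may quantify it after `N₀`.
-/

noncomputable section

open MeasureTheory Set Filter Topology
open scoped ENNReal Classical

namespace Summit.AtomisticToContinuum.HydrodynamicLimit.Theorems.KickFairRelEquilibriumMesoLine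

open Literature.Analysis.FluidPDE Literature.MathematicalPhysics.KineticTheory

variable {σ : ℝ} {N : ℕ}

section Hyp

variable (Φ : Flow σ N) (τ r tw A : ℝ)

/-- The long-flight event `L k = P_k⁻¹ {IsLong A tw}` of `k = (i, n)` is an `m k`-event (`measurableSet_isLong`). [folklore] -/
theorem measurableSet_longEv (i : Fin (N + 1)) (n : ℕ) :
    MeasurableSet[pastSA Φ r i n] ((fun z => past Φ r z i n) ⁻¹' {p : Past N | IsLong A tw p}) := by
  unfold pastSA
  exact comap_measurable _ (measurableSet_isLong N A tw)

/-- The long validity event `v k ∩ L k` is an `m k`-event. [folklore] -/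
theorem measurableSet_winEv_inter_longEv (v : ℕ) (i : Fin (N + 1)) (n : ℕ) :
    MeasurableSet[pastSA Φ r i n] (winEv Φ τ r tw v i n ∩ (fun z => past Φ r z i n) ⁻¹' {p : Past N | IsLong A tw p}) :=
  (measurableSet_winEv Φ τ r tw v i n).inter (measurableSet_longEv Φ r tw A i n)

/-- `|w k| ≤ 1_{v k ∩ L k}`: `|h| ≤ 1` and `h` VANISHES OFF LONG FLIGHTS, so off `L k` the weight is `0`. [folklore] -/
theorem abs_winWt_le_long {h : Fin (N + 1) → ℕ → Past N → ℝ} (hhb : ∀ i n p, |h i n p| ≤ 1)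
    (hvan : ∀ i n p, ¬ IsLong A tw p → h i n p = 0) (v : ℕ) (i : Fin (N + 1)) (n : ℕ) (z : Phase N) :
    |winWt Φ τ r tw h v i n z| ≤
      (winEv Φ τ r tw v i n ∩ (fun z => past Φ r z i n) ⁻¹' {p : Past N | IsLong A tw p}).indicator (fun _ => (1 : ℝ)) z := by
  by_cases hL : IsLong A tw (past Φ r z i n)
  · refine (abs_winWt_le Φ τ r tw hhb v i n z).trans (le_of_eq ?_)
    have hzL : z ∈ (fun z => past Φ r z i n) ⁻¹' {p : Past N | IsLong A tw p} := hL
    by_cases hw : z ∈ winEv Φ τ r tw v i n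
    · rw [Set.indicator_of_mem hw, Set.indicator_of_mem (Set.mem_inter hw hzL)]
    · rw [Set.indicator_of_notMem hw, Set.indicator_of_notMem fun h' => hw h'.1]
  · have h0 : winWt Φ τ r tw h v i n z = 0 := by
      unfold winWt wt wtFun
      rw [hvan i n _ hL, mul_zero, mul_zero]
    rw [h0, abs_zero]
    exact Set.indicator_nonneg (fun _ _ => zero_le_one) _

/-- `o k l = {PairFarL (P_k) (P_l)}` is an `mA k l`-event: `PairFarL` is Borel in the pair of pasts (`measurableSet_pairFarL`). [folklore] -/
theorem measurableSet_farEvL_joinSA (i : Fin (N + 1)) (n : ℕ) (i' : Fin (N + 1)) (n' : ℕ) :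
    MeasurableSet[joinSA Φ r i n i' n'] {z | PairFarL r A tw (past Φ r z i n) (past Φ r z i' n') i i'} := by
  have h : {z | PairFarL r A tw (past Φ r z i n) (past Φ r z i' n') i i'} =
      (fun z : Phase N => (past Φ r z i n, past Φ r z i' n')) ⁻¹' {q : Past N × Past N | PairFarL r A tw q.1 q.2 i i'} := rfl
  rw [h]
  exact comap_measurable _ (measurableSet_pairFarL N r A tw i i')

/-- `o l k` is an `mA k l`-event as well (preimage under the swapped pair map). [folklore] -/
theorem measurableSet_farEvL_swap_joinSA (i : Fin (N + 1)) (n : ℕ) (i' : Fin (N + 1)) (n' : ℕ) :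
    MeasurableSet[joinSA Φ r i n i' n'] {z | PairFarL r A tw (past Φ r z i' n') (past Φ r z i n) i' i} := by
  have h : {z | PairFarL r A tw (past Φ r z i' n') (past Φ r z i n) i' i} =
      (fun z : Phase N => (past Φ r z i n, past Φ r z i' n')) ⁻¹'
        ((fun t : Past N × Past N => (t.2, t.1)) ⁻¹' {q : Past N × Past N | PairFarL r A tw q.1 q.2 i' i}) := rfl
  rw [h]
  exact comap_measurable _ ((measurableSet_pairFarL N r A tw i' i).preimage (measurable_snd.prodMk measurable_fst))

/-- The long close-pair event `{L_k ∧ L_l ∧ PairCloseL (P_k) (P_l)}` (the event counted by CPL) is Borel. [folklore] -/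
theorem measurableSet_closeEvL (i : Fin (N + 1)) (n : ℕ) (i' : Fin (N + 1)) (n' : ℕ) :
    MeasurableSet {z | IsLong A tw (past Φ r z i n) ∧ IsLong A tw (past Φ r z i' n') ∧
      PairCloseL r A tw (past Φ r z i n) (past Φ r z i' n') i i'} := by
  have h : {z | IsLong A tw (past Φ r z i n) ∧ IsLong A tw (past Φ r z i' n') ∧
      PairCloseL r A tw (past Φ r z i n) (past Φ r z i' n') i i'} = (fun z : Phase N => (past Φ r z i n, past Φ r z i' n')) ⁻¹'
        ((Prod.fst ⁻¹' {p : Past N | IsLong A tw p}) ∩ ((Prod.snd ⁻¹' {p : Past N | IsLong A tw p}) ∩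
          {q : Past N × Past N | PairCloseL r A tw q.1 q.2 i i'})) := rfl
  rw [h]
  exact (((measurableSet_isLong N A tw).preimage measurable_fst).inter
    (((measurableSet_isLong N A tw).preimage measurable_snd).inter (measurableSet_pairCloseL N r A tw i i'))).preimage
      (measurable_pastJoin Φ r i n i' n')

/-- **Inside a common window "not far" is "close" (rev 5)**:
`(v^v_k ∩ L_k) ∩ (v^v_l ∩ L_l) ∩ (farL k l)ᶜ ∩ (farL l k)ᶜ ⊆ v^v_k ∩ v^v_l ∩ {L_k ∧ L_l ∧ PairCloseL}` (two valid times with the same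
`ℕ`-window index have the same `ℤ`-window index; `PairFarL = SameWindow ∧ ¬ NearOrFast`, `PairCloseL = SameWindow ∧ NearOrFast`). [folklore] -/
theorem winEvL_inter_subset_closeEvL {τ tw : ℝ} (htw : 0 < tw) (A : ℝ) (v : ℕ) (i : Fin (N + 1)) (n : ℕ)
    (i' : Fin (N + 1)) (n' : ℕ) :
    winEv Φ τ r tw v i n ∩ (fun z => past Φ r z i n) ⁻¹' {p : Past N | IsLong A tw p} ∩
          (winEv Φ τ r tw v i' n' ∩ (fun z => past Φ r z i' n') ⁻¹' {p : Past N | IsLong A tw p}) ∩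
        {z | PairFarL r A tw (past Φ r z i n) (past Φ r z i' n') i i'}ᶜ ∩
        {z | PairFarL r A tw (past Φ r z i' n') (past Φ r z i n) i' i}ᶜ ⊆
      winEv Φ τ r tw v i n ∩ winEv Φ τ r tw v i' n' ∩ {z | IsLong A tw (past Φ r z i n) ∧ IsLong A tw (past Φ r z i' n') ∧
        PairCloseL r A tw (past Φ r z i n) (past Φ r z i' n') i i'} := by
  rintro z ⟨⟨⟨⟨hk, hkL⟩, hl, hlL⟩, hf⟩, -⟩
  simp only [winEv, Set.mem_preimage, Set.mem_setOf_eq] at hk hl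
  have hs : SameWindow tw (past Φ r z i n) (past Φ r z i' n') := by
    unfold SameWindow
    rw [← Int.natCast_floor_eq_floor (div_pos hk.1.1 htw).le, ← Int.natCast_floor_eq_floor (div_pos hl.1.1 htw).le,
      hk.2, hl.2]
  exact ⟨⟨hk, hl⟩, hkL, hlL, hs, by_contra fun hc => hf ⟨hs, hc⟩⟩

/-- The far piece as the SWL event: `(v^v_k ∩ L_k) ∩ (v^v_l ∩ L_l) ∩ farL k l = v^v_k ∩ v^v_l ∩ {L_k ∧ L_l ∧ PairFarL}`. [folklore] -/
theorem winEvL_inter_farEvL_eq (v : ℕ) (i : Fin (N + 1)) (n : ℕ) (i' : Fin (N + 1)) (n' : ℕ) :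
    winEv Φ τ r tw v i n ∩ (fun z => past Φ r z i n) ⁻¹' {p : Past N | IsLong A tw p} ∩
          (winEv Φ τ r tw v i' n' ∩ (fun z => past Φ r z i' n') ⁻¹' {p : Past N | IsLong A tw p}) ∩
        {z | PairFarL r A tw (past Φ r z i n) (past Φ r z i' n') i i'} =
      winEv Φ τ r tw v i n ∩ winEv Φ τ r tw v i' n' ∩ {z | IsLong A tw (past Φ r z i n) ∧ IsLong A tw (past Φ r z i' n') ∧
        PairFarL r A tw (past Φ r z i n) (past Φ r z i' n') i i'} := by
  ext z
  simp only [Set.mem_inter_iff, Set.mem_preimage, Set.mem_setOf_eq]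
  tauto

end Hyp

/-- **`truncatedFluctuationLong_of_window` — the long-flight kinetic-window cut: SWL ∧ CPL ⟹ TFL.** See the module docstring:
obtain SWL / CPL at the flight cut `A` with the targets of `window_targets_le_sq`, take `N₀ := max`, and for `N ≥ N₀`, any index level
`A'` and any weight `h` vanishing off long flights run the fixed-`N` argument of `truncatedFluctuation_of_window` with `M := idxCut A' N`,
validity events `winEv ∩ P⁻¹{IsLong}` and order events `{PairFarL}`. [folklore] -/
theorem truncatedFluctuationLong_of_window :
    SameWindowPairCovLong rs → ClosePairCountLong rs → TruncatedFluctuationLong rs := by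
  intro hSW hCP a₀ θ₀ u₀ ha hθ hu ha0 hθ0
  obtain ⟨σ₁, hσ₁, H1⟩ := hSW a₀ θ₀ u₀ ha hθ hu ha0 hθ0
  obtain ⟨σ₂, hσ₂, H2⟩ := hCP a₀ θ₀ u₀ ha hθ hu ha0 hθ0
  refine ⟨min (min σ₁ σ₂) (1 / 2), lt_min (lt_min hσ₁ hσ₂) (by norm_num), ?_⟩
  intro σ hσ hσlt Φ τ hτ g hg hgb A hA δ hδ
  obtain ⟨C, hC⟩ := hgb
  have hσ1' : σ < σ₁ := hσlt.trans_le ((min_le_left _ _).trans (min_le_left _ _))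
  have hσ2' : σ < σ₂ := hσlt.trans_le ((min_le_left _ _).trans (min_le_right _ _))
  have hσ2 : σ ≤ 1 / 2 := (hσlt.trans_le (min_le_right _ _)).le
  have hC0 : 0 ≤ C := (abs_nonneg _).trans (hC 0)
  -- the targets for SWL and CPL
  set δ₁ : ℝ := δ ^ 2 / (4 * (τ + 1))
  set δ₂ : ℝ := δ ^ 2 / (32 * C ^ 2 * (τ + 1) + 1)
  have hδ₁0 : 0 < δ₁ := by positivity
  have hδ₂0 : 0 < δ₂ := by positivity
  obtain ⟨N₁, hN₁⟩ := H1 σ hσ hσ1' Φ τ hτ g hg ⟨C, hC⟩ A hA δ₁ hδ₁0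
  obtain ⟨N₂, hN₂⟩ := H2 σ hσ hσ2' Φ τ hτ A hA δ₂ hδ₂0
  refine ⟨max N₁ N₂, fun N hN A' _ h hhm hhb hvan => ?_⟩
  have hSWN := hN₁ N (le_of_max_le_left hN)
  have hCPN := hN₂ N (le_of_max_le_right hN)
  set LG := localGibbsLaw σ a₀ u₀ θ₀ N (Φ N)
  haveI : IsProbabilityMeasure LG := isProbabilityMeasure_localGibbsLaw ha hθ hu ha0 hθ0 hσ2 N (Φ N)
  set c : ℝ := hsDiameter σ N / ((N : ℝ) + 1)
  have hc0 : 0 ≤ c := div_nonneg (hsDiameter_pos hσ N).le (by positivity)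
  set M : ℕ := idxCut A' N
  set r : ℝ := rs N
  set tw : ℝ := tN N
  have htw0 : 0 < tw := tN_pos N
  set β := fun i n => betaLG σ a₀ θ₀ u₀ (Φ N) r g i n
  set Γ := fun i n i' n' => pairCondCovLG σ a₀ θ₀ u₀ (Φ N) r g i n i' n'
  set D := fun i n => kickDev (Φ N) r g i n
  set w := fun v i n => winWt (Φ N) τ r tw h v i n with hw
  set T : ℕ → Phase N → ℝ := fun v z => ∑ k : Fin (N + 1) × Fin M, w v k.1 k.2 z * (D k.1 k.2 z - β k.1 k.2 z) with hT
  set Sf := fun z => ∑ k : Fin (N + 1) × Fin M, wt (Φ N) τ r h k.1 k.2 z * (D k.1 k.2 z - β k.1 k.2 z) with hSf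
  -- Step 0: the truncated sum is a.e. `c · S` (`truncSum_ae_eq` at the level `A'`); reduce to `c ∫ |S| ≤ δ`
  refine (lintegral_congr_ae (g := fun z => ENNReal.ofReal (c * |Sf z|)) ?_).trans_le ?_
  · filter_upwards [truncSum_ae_eq σ N a₀ θ₀ u₀ hσ2 (Φ N) τ r g A' h] with z hz
    rw [hz, abs_mul, abs_of_nonneg hc0]
  set P : ℝ := ((N : ℝ) + 1) ^ (1 / 3 : ℝ)
  have hP0 : 0 < P := by positivity
  have haeD := ae_forall_abs_kickDev_le (a₀ := a₀) (θ₀ := θ₀) (u₀ := u₀) hσ2 (Φ N) r hC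
  have haeβ := ae_forall_abs_betaLG_le (a₀ := a₀) (θ₀ := θ₀) (u₀ := u₀) hσ2 (Φ N) r hC
  have haeΓ := ae_forall_abs_pairCondCovLG_le (a₀ := a₀) (θ₀ := θ₀) (u₀ := u₀) hσ2 (Φ N) r hC
  have haecut := ae_forall_lt_cnt_iff_pastTime (a₀ := a₀) (θ₀ := θ₀) (u₀ := u₀) hσ2 (Φ N) τ r
  -- Step 1: the abstract pair expansion PE″ window by window, validity cut to long flights, far pairs as order events
  set X : ℕ → ℝ := fun v => ∑ k : Fin (N + 1) × Fin M, ∑ l : Fin (N + 1) × Fin M,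
      ∫ z, (winEv (Φ N) τ r tw v k.1 k.2 ∩ (fun y => past (Φ N) r y k.1 k.2) ⁻¹' {p : Past N | IsLong A tw p} ∩
          (winEv (Φ N) τ r tw v l.1 l.2 ∩ (fun y => past (Φ N) r y l.1 l.2) ⁻¹' {p : Past N | IsLong A tw p}) ∩
          {y | PairFarL r A tw (past (Φ N) r y k.1 k.2) (past (Φ N) r y l.1 l.2) k.1 l.1}).indicator
        (fun _ => (1 : ℝ)) z * |Γ k.1 k.2 l.1 l.2 z| ∂LG
  set Y : ℕ → ℝ := fun v => ∑ k : Fin (N + 1) × Fin M, ∑ l : Fin (N + 1) × Fin M,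
      LG.real (winEv (Φ N) τ r tw v k.1 k.2 ∩ (fun y => past (Φ N) r y k.1 k.2) ⁻¹' {p : Past N | IsLong A tw p} ∩
        (winEv (Φ N) τ r tw v l.1 l.2 ∩ (fun y => past (Φ N) r y l.1 l.2) ⁻¹' {p : Past N | IsLong A tw p}) ∩
        {y | PairFarL r A tw (past (Φ N) r y k.1 k.2) (past (Φ N) r y l.1 l.2) k.1 l.1}ᶜ ∩
        {y | PairFarL r A tw (past (Φ N) r y l.1 l.2) (past (Φ N) r y k.1 k.2) l.1 k.1}ᶜ)
  have hPEv : ∀ v, ∫ z, T v z ^ 2 ∂LG ≤ 2 * X v + 4 * (2 * C) ^ 2 * Y v := fun v =>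
    stub_pairExpansion2 (Phase N) inferInstance LG (Fin (N + 1) × Fin M)
      (fun k => pastSA (Φ N) r k.1 k.2) (fun k l => joinSA (Φ N) r k.1 k.2 l.1 l.2)
      (fun k => D k.1 k.2) (fun k => w v k.1 k.2)
      (fun k => winEv (Φ N) τ r tw v k.1 k.2 ∩ (fun y => past (Φ N) r y k.1 k.2) ⁻¹' {p : Past N | IsLong A tw p})
      (fun k l => {y | PairFarL r A tw (past (Φ N) r y k.1 k.2) (past (Φ N) r y l.1 l.2) k.1 l.1}) (2 * C) (by positivity)
      (fun k => pastSA_le (Φ N) r k.1 k.2) (fun k l => joinSA_le (Φ N) r k.1 k.2 l.1 l.2)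
      (fun k l => pastSA_le_joinSA_left (Φ N) r k.1 k.2 l.1 l.2) (fun k l => pastSA_le_joinSA_right (Φ N) r k.1 k.2 l.1 l.2)
      (fun k => integrable_of_ae_abs_le (measurable_kickDev (Φ N) r hg k.1 k.2).aestronglyMeasurable
        (haeD.mono fun z hz => hz k.1 k.2))
      (fun k => haeD.mono fun z hz => hz k.1 k.2)
      (fun k => stronglyMeasurable_winWt (Φ N) τ r tw hhm v k.1 k.2)
      (fun k => measurableSet_winEv_inter_longEv (Φ N) τ r tw A v k.1 k.2)
      (fun k z => abs_winWt_le_long (Φ N) τ r tw A hhb hvan v k.1 k.2 z)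
      (fun k l => measurableSet_farEvL_joinSA (Φ N) r tw A k.1 k.2 l.1 l.2)
      (fun k l => measurableSet_farEvL_swap_joinSA (Φ N) r tw A k.1 k.2 l.1 l.2)
  -- Step 2: integrability of the window sums
  have hwm : ∀ v i n, Measurable (w v i n) := fun v i n =>
    ((measurable_winFun tw v).comp (measurable_past (Φ N) r i n)).mul (measurable_wt (Φ N) τ r hhm i n)
  have hw1 : ∀ v i n z, |w v i n z| ≤ 1 := fun v i n z =>
    (abs_winWt_le (Φ N) τ r tw hhb v i n z).trans (Set.indicator_le_self' (fun _ _ => zero_le_one) z)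
  have hTm : ∀ v, Measurable (T v) := fun v => Finset.measurable_sum _ fun k _ => (hwm v k.1 k.2).mul
    ((measurable_kickDev (Φ N) r hg k.1 k.2).sub (measurable_betaLG_borel (Φ N) r g k.1 k.2))
  have hTb : ∀ v, ∀ᵐ z ∂LG, |T v z| ≤ ∑ _k : Fin (N + 1) × Fin M, 4 * C := fun v => by
    filter_upwards [haeD, haeβ] with z hDz hβz
    refine (Finset.abs_sum_le_sum_abs _ _).trans (Finset.sum_le_sum fun k _ => ?_)
    rw [abs_mul]
    exact (mul_le_mul (hw1 v k.1 k.2 z) ((abs_sub _ _).trans (add_le_add (hDz k.1 k.2) (hβz k.1 k.2))) (abs_nonneg _)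
      zero_le_one).trans_eq (by ring)
  have hTi : ∀ v, Integrable (T v) LG := fun v => integrable_of_ae_abs_le (hTm v).aestronglyMeasurable (hTb v)
  have hT2i : ∀ v, Integrable (fun z => T v z ^ 2) LG := fun v =>
    integrable_of_ae_abs_le ((hTm v).pow_const 2).aestronglyMeasurable
      ((hTb v).mono fun z hz => (abs_pow (T v z) 2).trans_le (pow_le_pow_left₀ (abs_nonneg _) hz 2))
  -- Step 3: window decomposition `S = Σ_v T_v`, triangle inequality, Cauchy–Schwarz over the windows
  have hSfeq : ∀ z, Sf z = ∑ v ∈ Finset.range (⌊τ / tw⌋₊ + 1), T v z := fun z => by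
    simp only [hT, hSf, hw]
    rw [Finset.sum_comm]
    exact Finset.sum_congr rfl fun k _ => by rw [← Finset.sum_mul, sum_winWt (Φ N) r htw0]
  have hSfi : Integrable Sf LG :=
    (integrable_finsetSum _ fun v _ => hTi v).congr (ae_of_all _ fun z => (hSfeq z).symm)
  have hI1 : ∫ z, |Sf z| ∂LG ≤ ∑ v ∈ Finset.range (⌊τ / tw⌋₊ + 1), ∫ z, |T v z| ∂LG := by
    rw [← integral_finsetSum _ fun v _ => (hTi v).abs]
    exact integral_mono_of_nonneg (ae_of_all _ fun z => abs_nonneg _) (integrable_finsetSum _ fun v _ => (hTi v).abs)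
      (ae_of_all _ fun z => (congrArg abs (hSfeq z)).trans_le (Finset.abs_sum_le_sum_abs _ _))
  have hI2 : (∑ v ∈ Finset.range (⌊τ / tw⌋₊ + 1), ∫ z, |T v z| ∂LG) ^ 2 ≤
      ((⌊τ / tw⌋₊ + 1 : ℕ) : ℝ) * ∑ v ∈ Finset.range (⌊τ / tw⌋₊ + 1), ∫ z, T v z ^ 2 ∂LG := by
    refine (sq_sum_le_card_mul_sum_sq (s := Finset.range _) (f := fun v => ∫ z, |T v z| ∂LG)).trans ?_
    rw [Finset.card_range]
    exact mul_le_mul_of_nonneg_left (Finset.sum_le_sum fun v _ => sq_integral_abs_le_integral_sq (hTi v) (hT2i v))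
      (Nat.cast_nonneg _)
  have hsum : ∑ v ∈ Finset.range (⌊τ / tw⌋₊ + 1), ∫ z, T v z ^ 2 ∂LG ≤
      2 * ∑ v ∈ Finset.range (⌊τ / tw⌋₊ + 1), X v + 4 * (2 * C) ^ 2 * ∑ v ∈ Finset.range (⌊τ / tw⌋₊ + 1), Y v := by
    rw [Finset.mul_sum, Finset.mul_sum, ← Finset.sum_add_distrib]
    exact Finset.sum_le_sum fun v _ => hPEv v
  -- Step 4: the far pairs, `P c² Σ_v X_v ≤ δ₁` (SWL)
  have hVm : ∀ v (k : Fin (N + 1) × Fin M), MeasurableSet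
      (winEv (Φ N) τ r tw v k.1 k.2 ∩ (fun y => past (Φ N) r y k.1 k.2) ⁻¹' {p : Past N | IsLong A tw p}) := fun v k =>
    pastSA_le (Φ N) r k.1 k.2 _ (measurableSet_winEv_inter_longEv (Φ N) τ r tw A v k.1 k.2)
  have hWm : ∀ v (k : Fin (N + 1) × Fin M), MeasurableSet (winEv (Φ N) τ r tw v k.1 k.2) := fun v k =>
    pastSA_le (Φ N) r k.1 k.2 _ (measurableSet_winEv (Φ N) τ r tw v k.1 k.2)
  have hFi : ∀ v (k l : Fin (N + 1) × Fin M), Integrable (fun z =>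
      (winEv (Φ N) τ r tw v k.1 k.2 ∩ (fun y => past (Φ N) r y k.1 k.2) ⁻¹' {p : Past N | IsLong A tw p} ∩
          (winEv (Φ N) τ r tw v l.1 l.2 ∩ (fun y => past (Φ N) r y l.1 l.2) ⁻¹' {p : Past N | IsLong A tw p}) ∩
          {y | PairFarL r A tw (past (Φ N) r y k.1 k.2) (past (Φ N) r y l.1 l.2) k.1 l.1}).indicator
        (fun _ => (1 : ℝ)) z * |Γ k.1 k.2 l.1 l.2 z|) LG := by
    intro v k l
    refine integrable_of_ae_abs_le (((measurable_const.indicator (((hVm v k).inter (hVm v l)).inter (joinSA_le (Φ N) r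
      k.1 k.2 l.1 l.2 _ (measurableSet_farEvL_joinSA (Φ N) r tw A k.1 k.2 l.1 l.2)))).mul
      (measurable_pairCondCovLG (Φ N) r g k.1 k.2 l.1 l.2).abs).aestronglyMeasurable) (B := 1 * (4 * C) ^ 2) ?_
    filter_upwards [haeΓ] with z h1
    rw [abs_mul, abs_abs, abs_of_nonneg (Set.indicator_nonneg (fun _ _ => zero_le_one) _)]
    exact mul_le_mul (Set.indicator_le_self' (fun _ _ => zero_le_one) z) (h1 k.1 k.2 l.1 l.2) (abs_nonneg _)
      zero_le_one
  have hXb : P * c ^ 2 * ∑ v ∈ Finset.range (⌊τ / tw⌋₊ + 1), X v ≤ δ₁ := by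
    have hEq : P * c ^ 2 * ∑ v ∈ Finset.range (⌊τ / tw⌋₊ + 1), X v = ∫ z, P * c ^ 2 *
        ∑ v ∈ Finset.range (⌊τ / tw⌋₊ + 1), ∑ k : Fin (N + 1) × Fin M, ∑ l : Fin (N + 1) × Fin M,
          (winEv (Φ N) τ r tw v k.1 k.2 ∩ (fun y => past (Φ N) r y k.1 k.2) ⁻¹' {p : Past N | IsLong A tw p} ∩
              (winEv (Φ N) τ r tw v l.1 l.2 ∩ (fun y => past (Φ N) r y l.1 l.2) ⁻¹' {p : Past N | IsLong A tw p}) ∩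
              {y | PairFarL r A tw (past (Φ N) r y k.1 k.2) (past (Φ N) r y l.1 l.2) k.1 l.1}).indicator
            (fun _ => (1 : ℝ)) z * |Γ k.1 k.2 l.1 l.2 z| ∂LG := by
      rw [integral_const_mul, integral_finsetSum _ fun v _ => integrable_finsetSum _ fun k _ =>
        integrable_finsetSum _ fun l _ => hFi v k l]
      refine congrArg _ (Finset.sum_congr rfl fun v _ => ?_)
      rw [integral_finsetSum _ fun k _ => integrable_finsetSum _ fun l _ => hFi v k l]
      exact Finset.sum_congr rfl fun k _ => (integral_finsetSum _ fun l _ => hFi v k l).symm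
    rw [hEq]
    refine integral_le_of_lintegral_ofReal_le (ae_of_all _ fun z => ?_) ((integrable_finsetSum _ fun v _ =>
      integrable_finsetSum _ fun k _ => integrable_finsetSum _ fun l _ => hFi v k l).const_mul _).aestronglyMeasurable
      (haecut.mono fun z hz => ?_) hSWN hδ₁0.le
    · exact mul_nonneg (by positivity) (Finset.sum_nonneg fun v _ => Finset.sum_nonneg fun k _ =>
        Finset.sum_nonneg fun l _ => mul_nonneg (Set.indicator_nonneg (fun _ _ => zero_le_one) _) (abs_nonneg _))
    · refine mul_le_mul_of_nonneg_left (le_trans (le_of_eq ?_) (windowPairSum_le (Φ N) τ r tw (⌊τ / tw⌋₊ + 1) M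
        (fun i n i' n' => (if IsLong A tw (past (Φ N) r z i n) ∧ IsLong A tw (past (Φ N) r z i' n') ∧
            PairFarL r A tw (past (Φ N) r z i n) (past (Φ N) r z i' n') i i' then (1 : ℝ) else 0) *
          |Γ i n i' n' z|) (fun _ _ _ _ => by positivity) hz)) (by positivity)
      refine Finset.sum_congr rfl fun v _ => Fintype.sum_congr _ _ fun k => Fintype.sum_congr _ _ fun l => ?_
      rw [winEvL_inter_farEvL_eq, indicator_inter_setOf, mul_assoc]
      -- the two `if`s carry different (subsingleton) `Decidable` instances
      congr
  -- Step 5: the close pairs, `P c² Σ_v Y_v ≤ δ₂` (CPL)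
  have hGm : ∀ v (k l : Fin (N + 1) × Fin M), MeasurableSet (winEv (Φ N) τ r tw v k.1 k.2 ∩ winEv (Φ N) τ r tw v l.1 l.2 ∩
      {y | IsLong A tw (past (Φ N) r y k.1 k.2) ∧ IsLong A tw (past (Φ N) r y l.1 l.2) ∧
        PairCloseL r A tw (past (Φ N) r y k.1 k.2) (past (Φ N) r y l.1 l.2) k.1 l.1}) :=
    fun v k l => ((hWm v k).inter (hWm v l)).inter (measurableSet_closeEvL (Φ N) r tw A _ _ _ _)
  have hGi : ∀ v (k l : Fin (N + 1) × Fin M), Integrable (fun z =>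
      (winEv (Φ N) τ r tw v k.1 k.2 ∩ winEv (Φ N) τ r tw v l.1 l.2 ∩
        {y | IsLong A tw (past (Φ N) r y k.1 k.2) ∧ IsLong A tw (past (Φ N) r y l.1 l.2) ∧
          PairCloseL r A tw (past (Φ N) r y k.1 k.2) (past (Φ N) r y l.1 l.2) k.1 l.1}).indicator
        (fun _ => (1 : ℝ)) z) LG := fun v k l => (integrable_const _).indicator (hGm v k l)
  have hYle : ∀ v, Y v ≤ ∑ k : Fin (N + 1) × Fin M, ∑ l : Fin (N + 1) × Fin M,
      ∫ z, (winEv (Φ N) τ r tw v k.1 k.2 ∩ winEv (Φ N) τ r tw v l.1 l.2 ∩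
        {y | IsLong A tw (past (Φ N) r y k.1 k.2) ∧ IsLong A tw (past (Φ N) r y l.1 l.2) ∧
          PairCloseL r A tw (past (Φ N) r y k.1 k.2) (past (Φ N) r y l.1 l.2) k.1 l.1}).indicator
        (fun _ => (1 : ℝ)) z ∂LG := fun v =>
    Finset.sum_le_sum fun k _ => Finset.sum_le_sum fun l _ => by
      rw [integral_indicator_const _ (hGm v k l), smul_eq_mul, mul_one]
      exact measureReal_mono (winEvL_inter_subset_closeEvL (Φ N) r htw0 A v k.1 k.2 l.1 l.2)
  have hYb : P * c ^ 2 * ∑ v ∈ Finset.range (⌊τ / tw⌋₊ + 1), Y v ≤ δ₂ := by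
    have hle : P * c ^ 2 * ∑ v ∈ Finset.range (⌊τ / tw⌋₊ + 1), Y v ≤ ∫ z, P * c ^ 2 *
        ∑ v ∈ Finset.range (⌊τ / tw⌋₊ + 1), ∑ k : Fin (N + 1) × Fin M, ∑ l : Fin (N + 1) × Fin M,
          (winEv (Φ N) τ r tw v k.1 k.2 ∩ winEv (Φ N) τ r tw v l.1 l.2 ∩
            {y | IsLong A tw (past (Φ N) r y k.1 k.2) ∧ IsLong A tw (past (Φ N) r y l.1 l.2) ∧
              PairCloseL r A tw (past (Φ N) r y k.1 k.2) (past (Φ N) r y l.1 l.2) k.1 l.1}).indicator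
            (fun _ => (1 : ℝ)) z ∂LG := by
      rw [integral_const_mul, integral_finsetSum _ fun v _ => integrable_finsetSum _ fun k _ =>
        integrable_finsetSum _ fun l _ => hGi v k l]
      refine mul_le_mul_of_nonneg_left (Finset.sum_le_sum fun v _ => (hYle v).trans_eq ?_) (by positivity)
      rw [integral_finsetSum _ fun k _ => integrable_finsetSum _ fun l _ => hGi v k l]
      exact Finset.sum_congr rfl fun k _ => (integral_finsetSum _ fun l _ => hGi v k l).symm
    refine hle.trans (integral_le_of_lintegral_ofReal_le (ae_of_all _ fun z => ?_) ((integrable_finsetSum _ fun v _ =>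
      integrable_finsetSum _ fun k _ => integrable_finsetSum _ fun l _ => hGi v k l).const_mul _).aestronglyMeasurable
      (haecut.mono fun z hz => ?_) hCPN hδ₂0.le)
    · exact mul_nonneg (by positivity) (Finset.sum_nonneg fun v _ => Finset.sum_nonneg fun k _ =>
        Finset.sum_nonneg fun l _ => Set.indicator_nonneg (fun _ _ => zero_le_one) _)
    · refine mul_le_mul_of_nonneg_left (le_trans (le_of_eq ?_) (windowPairSum_le (Φ N) τ r tw (⌊τ / tw⌋₊ + 1) M
        (fun i n i' n' => if IsLong A tw (past (Φ N) r z i n) ∧ IsLong A tw (past (Φ N) r z i' n') ∧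
            PairCloseL r A tw (past (Φ N) r z i n) (past (Φ N) r z i' n') i i' then (1 : ℝ) else 0)
        (fun _ _ _ _ => by positivity) hz)) (by positivity)
      refine Finset.sum_congr rfl fun v _ => Fintype.sum_congr _ _ fun k => Fintype.sum_congr _ _ fun l => ?_
      rw [indicator_inter_setOf]
      congr
  -- Step 6: the conclusion `c ∫ |S| ≤ δ`
  have hWle : ((⌊τ / tw⌋₊ + 1 : ℕ) : ℝ) ≤ (τ + 1) * P := card_windows_le hτ.le N
  have hI0 : 0 ≤ ∫ z, |Sf z| ∂LG := integral_nonneg fun z => abs_nonneg _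
  have hmain : c * ∫ z, |Sf z| ∂LG ≤ δ := by
    refine (pow_le_pow_iff_left₀ (mul_nonneg hc0 hI0) hδ.le two_ne_zero).1 ?_
    calc (c * ∫ z, |Sf z| ∂LG) ^ 2 ≤ (c * ∑ v ∈ Finset.range (⌊τ / tw⌋₊ + 1), ∫ z, |T v z| ∂LG) ^ 2 :=
          pow_le_pow_left₀ (mul_nonneg hc0 hI0) (mul_le_mul_of_nonneg_left hI1 hc0) 2
      _ ≤ c ^ 2 * (((⌊τ / tw⌋₊ + 1 : ℕ) : ℝ) * ∑ v ∈ Finset.range (⌊τ / tw⌋₊ + 1), ∫ z, T v z ^ 2 ∂LG) := by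
          rw [mul_pow]; exact mul_le_mul_of_nonneg_left hI2 (sq_nonneg _)
      _ ≤ c ^ 2 * (((τ + 1) * P) * (2 * ∑ v ∈ Finset.range (⌊τ / tw⌋₊ + 1), X v +
            4 * (2 * C) ^ 2 * ∑ v ∈ Finset.range (⌊τ / tw⌋₊ + 1), Y v)) :=
          mul_le_mul_of_nonneg_left (mul_le_mul hWle hsum
            (Finset.sum_nonneg fun v _ => integral_nonneg fun z => sq_nonneg _) (by positivity)) (sq_nonneg _)
      _ = (τ + 1) * (2 * (P * c ^ 2 * ∑ v ∈ Finset.range (⌊τ / tw⌋₊ + 1), X v) +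
            4 * (2 * C) ^ 2 * (P * c ^ 2 * ∑ v ∈ Finset.range (⌊τ / tw⌋₊ + 1), Y v)) := by ring
      _ ≤ (τ + 1) * (2 * δ₁ + 4 * (2 * C) ^ 2 * δ₂) := by gcongr
      _ ≤ δ ^ 2 := window_targets_le_sq C δ hτ
  -- Step 7: back to the `lintegral` statement
  show ∫⁻ z, ENNReal.ofReal (c * |Sf z|) ∂LG ≤ ENNReal.ofReal δ
  rw [← ofReal_integral_eq_lintegral_ofReal (hSfi.abs.const_mul c) (ae_of_all _ fun z => mul_nonneg hc0 (abs_nonneg _))]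
  refine ENNReal.ofReal_le_ofReal ?_
  rw [integral_const_mul]
  exact hmain

end Summit.AtomisticToContinuum.HydrodynamicLimit.Theorems.KickFairRelEquilibriumMesoLine

end
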